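import Literature.AlgebraicGeometry.Motives.HodgeLieWeightOneSimpleOfSmallRank
import Literature.AlgebraicGeometry.Motives.HodgeLieWeightOneRankTwelveReduction
import HarnessLib

/-!
# Weight one, `End_Hdg = ℚ`: if the minimal raising rank `r` satisfies `r ≤ 4` and `r < dim V^{1,0}`, then `Lie Hg ⊗ ℂ` is SIMPLE
# (seven independent elements of the `Θ`-ideal; Moonen–Zarhin 1999 (2.3), Deligne I §3)

Family `hodge`, layer `Literature/AlgebraicGeometry/Motives`; THEOREMS ONLY (no definition, no named fact; D-0026).  Written for the
cell `pub-hodgeav-hg6` (LADDER-HodgeAV row 2, TABLE X row 1 `g6.I(1)`: brick N10 of the row-1 programme «`End⁰ = ℚ`, `g = 6` ⟹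
`Hg = Sp₁₂`»; honest framing of that cell: HC / HC_AV / HC_CM NOT proved — unconditional Hodge–Lie linear algebra; this file does NOT
exclude `r ∈ {2, 3, 4}`: it shows that then `Lie Hg ⊗ ℂ` has no proper ideal, which excludes the two genuine complex product
configurations `𝔰𝔭₄ ⊕ 𝔰𝔬₃` on `ℂ⁴ ⊗ ℂ³` (`r = 3`) and `𝔰𝔩₂ ⊕ 𝔰𝔬₆` on `ℂ² ⊗ ℂ⁶` (`r = 4`) of the rank-twelve case).
Sequel of `HodgeLieWeightOneSimpleOfSmallRank` (N9, `r ≤ 3`); notation as there.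

* §1 **`WeightOnePeirce.seven_le_finrank`** — for the minimal tripotent `B` (`B C B = t B`, `E = t⁻¹ B C`, `F = t⁻¹ C B`) and a non-zero
  Peirce-`1` raising `y ∈ 𝔥_ℂ` (`y = E y + y F`, `E y F = 0`) with conjugate `ȳ`, the seven elements
  `B, y, C, ȳ, [B, C], [B, ȳ], [y, C]` are linearly independent, so any subspace containing them has dimension `≥ 7`.  PROOF: both
  halves `a = E y` (values in `U = range B`) and `a' = y F` (values in `U' = ker E ∩ P`) are non-zero, being `ψ_ℂ`-transposes of
  each other (`ψ_ℂ(a x, x') = ψ_ℂ(a' x', x)`); the `Θ`-grading separates raising / lowering / Levi parts; on `U'` the Levi elements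
  act by `[B, C] = 0`, `[y, C] = 0`, `[B, ȳ] u' = B ȳ u' ≠ 0` for some `u'`; on `U` by `[B, C] = t`, `[B, ȳ] = 0`, `[y, C] u ∈ U'`
  non-zero for some `u`.
* §2 **`hodgeLieC_simple_of_minimal_rank_le_four`** — `H` effective polarized of weight `1`, `End_Hdg = ℚ`, `B ∈ 𝔥_ℂ` raising,
  non-zero, of minimal rank `r ≤ 4` with `r < dim V^{1,0}`: every non-zero `ad 𝔥_ℂ`-stable subspace of `𝔥_ℂ` is `𝔥_ℂ` (N2 splitting
  `𝔥_ℂ = 𝔰₁ ⊕ 𝔠`; N8: `dim 𝔠 ≤ 6`; §1: `dim 𝔰₁ ≥ 7`; Jacobson clause ⟹ `𝔠 = 0`).  For the cell (`dim_ℚ V = 12`): in the second case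
  of `rankTwelve_sp_or_exists_minimal_raising` (N6), `Lie Hg ⊗ ℂ` is simple.

## References

* [MoonenZarhin1999LowDim] B. Moonen, Yu. Zarhin, *Hodge classes on abelian varieties of low dimension*, Math. Ann. 315 (1999),
  §2 (2.3)–(2.5), §3 (3.1).
* [Deligne1982HodgeCycles] P. Deligne, *Hodge cycles on abelian varieties*, LNM 900 (1982), I §3 (Prop. 3.4, 3.6, Example 3.7).
* [Jacobson1962LieAlgebras] N. Jacobson, *Lie algebras* (1962), Ch. X §1.
-/

noncomputable section

open scoped TensorProduct

namespace Literature.AlgebraicGeometry.Motives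

namespace HodgeStructure

universe u

variable {V : Type u} [AddCommGroup V] [Module ℚ V] [Module.Finite ℚ V] [HodgeTensorFacts.{u, u}] {n : ℤ}

/-! ## §1 Seven independent elements -/

set_option maxHeartbeats 3200000 in
/-- **Seven independent elements `B, y, C, ȳ, [B, C], [B, ȳ], [y, C]`** for a minimal tripotent `B` and a non-zero Peirce-`1` raising
`y ∈ 𝔥_ℂ`. [cite: MoonenZarhin1999LowDim, §2 (2.3)–(2.5)] [cite: Deligne1982HodgeCycles, I §3 Prop. 3.4, Prop. 3.6] -/
theorem WeightOnePeirce.seven_le_finrank (H : HodgeStructure V n) (ψ : H.Polarization) (hn : n = 1)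
    (heff : H.IsEffective) {Θ : Module.End ℂ (ℂ ⊗[ℚ] V)} (hΘ : ∀ p, ∀ x ∈ H.piece p (n - p), Θ x = ((2 * p - n : ℤ) : ℂ) • x)
    {B C : Module.End ℂ (ℂ ⊗[ℚ] V)} (hB : B ∈ H.hodgeLieC) (hB0 : B ≠ 0) (hBP : ∀ p ∈ H.piece 1 0, B p = 0)
    (hBim : ∀ v, B v ∈ H.piece 1 0) (hC : ∀ v, C v = conj (B (conj v))) (hC𝔊 : C ∈ H.hodgeLieC)
    {t : ℂ} (ht : t ≠ 0) (hBCB : B * C * B = t • B)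
    {y yb : Module.End ℂ (ℂ ⊗[ℚ] V)} (hy : y ∈ H.hodgeLieC) (hy0 : y ≠ 0) (hyP : ∀ p ∈ H.piece 1 0, y p = 0)
    (hyim : ∀ v, y v ∈ H.piece 1 0)
    (hy1 : t⁻¹ • (B * C) * y + y * (t⁻¹ • (C * B)) - (2 : ℂ) • (t⁻¹ • (B * C) * y * (t⁻¹ • (C * B))) = y)
    (hyB : ∀ s : ℂ, y ≠ s • B) (hyb : ∀ v, yb v = conj (y (conj v))) (hyb𝔊 : yb ∈ H.hodgeLieC)
    {𝔰 : Submodule ℂ (Module.End ℂ (ℂ ⊗[ℚ] V))} (hB𝔰 : B ∈ 𝔰) (hy𝔰 : y ∈ 𝔰) (hC𝔰 : C ∈ 𝔰) (hyb𝔰 : yb ∈ 𝔰)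
    (hL0 : B * C - C * B ∈ 𝔰) (hL1 : B * yb - yb * B ∈ 𝔰) (hL2 : y * C - C * y ∈ 𝔰) :
    7 ≤ Module.finrank ℂ 𝔰 := by
  classical
  obtain ⟨hCBC, htreal⟩ := WeightOnePeirce.conjOp_mul_conjOp_mul hC ht hB0 hBCB
  subst hn
  obtain ⟨hPmem, hQmem, hΘ10, hΘ01, hΘΘ⟩ := UnitaryTheta.theta_facts H rfl heff hΘ
  obtain ⟨hCQ, hCim, hcC, hcB⟩ := SymplecticThetaTen.conjOp_raise (P := H.piece 1 0) (Q := H.piece 0 1)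
    (fun x hx => conj_mem_piece H hx) (fun x hx => conj_mem_piece H hx) hBP hBim hC
  obtain ⟨hybQ, hybim, hcyb, hcy⟩ := SymplecticThetaTen.conjOp_raise (P := H.piece 1 0) (Q := H.piece 0 1)
    (fun x hx => conj_mem_piece H hx) (fun x hx => conj_mem_piece H hx) hyP hyim hyb
  have hTfix : ∀ x : ℂ ⊗[ℚ] V, Θ x = x → x ∈ H.piece 1 0 := fun x hx => by
    have h := hPmem x
    rwa [hx, ← two_smul ℂ x, smul_smul, inv_mul_cancel₀ (two_ne_zero' ℂ), one_smul] at h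
  have hPQ0 : ∀ x, x ∈ H.piece 1 0 → x ∈ H.piece 0 1 → x = 0 := fun x hP hQ => by
    have h1 := hΘ10 x hP
    rw [hΘ01 x hQ, neg_eq_iff_add_eq_zero, ← two_smul ℂ x, smul_eq_zero] at h1
    exact h1.resolve_left (two_ne_zero' ℂ)
  have hBB : B * B = 0 := LinearMap.ext fun v => by
    rw [Module.End.mul_apply, hBP _ (hBim v), LinearMap.zero_apply]
  have hCC : C * C = 0 := LinearMap.ext fun v => by
    rw [Module.End.mul_apply, hCQ _ (hCim v), LinearMap.zero_apply]
  obtain ⟨E, hE⟩ : ∃ E : Module.End ℂ (ℂ ⊗[ℚ] V), E = t⁻¹ • (B * C) := ⟨_, rfl⟩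
  obtain ⟨F, hF⟩ : ∃ F : Module.End ℂ (ℂ ⊗[ℚ] V), F = t⁻¹ • (C * B) := ⟨_, rfl⟩
  rw [← hE, ← hF] at hy1
  obtain ⟨hEE, hFF, hEB, hBF, hFC, hCE, hBE, hFB, hEF, hFE⟩ := WeightOnePeirce.tripotent_facts ht hBCB hCBC hBB hCC hE hF
  -- the form
  set ω := ψ.form.baseChange ℂ with hω
  have hωalt : ∀ x x', ω x x' = -ω x' x := fun x x' => by rw [hω, form_baseChange_swap_of_odd H odd_one ψ x' x]
  have hωnd : ω.Nondegenerate := by rw [hω]; exact ψ.nondegenerate_baseChange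
  have hBsk : ∀ x x', ω (B x) x' = -ω x (B x') := fun x x' => by rw [hω, formBaseChange_skew_of_mem_hodgeLieC ψ hB]
  have hCsk : ∀ x x', ω (C x) x' = -ω x (C x') := fun x x' => by rw [hω, formBaseChange_skew_of_mem_hodgeLieC ψ hC𝔊]
  have hysk : ∀ x x', ω (y x) x' = -ω x (y x') := fun x x' => by rw [hω, formBaseChange_skew_of_mem_hodgeLieC ψ hy]
  have hysymm : ∀ x x', ω (y x) x' = ω (y x') x := fun x x' => by rw [hysk, hωalt x, neg_neg]
  have hEFadj : ∀ x x', ω (E x) x' = ω x (F x') := fun x x' => by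
    rw [hE, hF, LinearMap.smul_apply, LinearMap.smul_apply, Module.End.mul_apply, Module.End.mul_apply, map_smul,
      LinearMap.smul_apply, map_smul, smul_eq_mul, smul_eq_mul, hBsk, hCsk, neg_neg]
  -- Peirce-1 relations: `E y F = 0`, `y = E y + y F`
  have hL : E * (E * y + y * F - (2 : ℂ) • (E * y * F)) * F = 0 := by
    have e1 : E * (E * y + y * F - (2 : ℂ) • (E * y * F)) = E * y + E * y * F - (2 : ℂ) • (E * y * F) := by
      rw [mul_sub, mul_add, ← mul_assoc E E y, hEE, ← mul_assoc E y F, mul_smul_comm, ← mul_assoc E (E * y) F,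
        ← mul_assoc E E y, hEE]
    rw [e1, sub_mul, add_mul, smul_mul_assoc, mul_assoc (E * y) F F, hFF, two_smul]
    abel
  have hEyF : E * y * F = 0 := by
    have h : E * (E * y + y * F - (2 : ℂ) • (E * y * F)) * F = E * y * F := congrArg (fun X => E * X * F) hy1
    rw [hL] at h
    exact h.symm
  have hysum : y = E * y + y * F := by
    have h := hy1
    rw [hEyF, smul_zero, sub_zero] at h
    exact h.symm
  -- the two halves `a = E y`, `a' = y F`
  obtain ⟨a, ha⟩ : ∃ a : Module.End ℂ (ℂ ⊗[ℚ] V), a = E * y := ⟨_, rfl⟩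
  obtain ⟨a', ha'⟩ : ∃ a' : Module.End ℂ (ℂ ⊗[ℚ] V), a' = y * F := ⟨_, rfl⟩
  have hya : y = a + a' := by rw [ha, ha']; exact hysum
  have haa' : ∀ x x', ω (a x) x' = ω (a' x') x := fun x x' => by
    rw [ha, ha', Module.End.mul_apply, Module.End.mul_apply, hEFadj, hysymm]
  have ha0 : a ≠ 0 := fun h0 => hy0 (by
    have ha'0 : a' = 0 := LinearMap.ext fun x' => hωnd.1 _ fun x => by
      rw [← haa', h0, LinearMap.zero_apply, map_zero, LinearMap.zero_apply]
    rw [hya, h0, ha'0, add_zero])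
  have ha'0 : a' ≠ 0 := fun h0 => hy0 (by
    have ha0' : a = 0 := LinearMap.ext fun x => hωnd.1 _ fun x' => by
      rw [haa', h0, LinearMap.zero_apply, map_zero, LinearMap.zero_apply]
    rw [hya, h0, ha0', zero_add])
  have haF : a * F = 0 := by rw [ha, hEyF]
  have hEa' : E * a' = 0 := by rw [ha', ← mul_assoc, hEyF]
  have haC : a * C = 0 := by
    rw [ha]
    conv_lhs => rw [← hFC]
    rw [← mul_assoc, hEyF, zero_mul]
  have hCa' : C * a' = 0 := by rw [← hCE, mul_assoc, hEa', mul_zero]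
  have hyC : y * C = a' * C := by rw [hya, add_mul, haC, zero_add]
  have haE : ∀ v, E (a v) = a v := fun v => by rw [ha, Module.End.mul_apply, ← Module.End.mul_apply E E, hEE]
  -- conjugation exchanges `E` and `F`
  have hconjF : ∀ w, conj (F w) = E (conj w) := fun w => by
    rw [hF, hE, LinearMap.smul_apply, LinearMap.smul_apply, Module.End.mul_apply, Module.End.mul_apply, conj_smul,
      map_inv₀, htreal, hcC, hcB]
  -- grading facts
  have hPQ : ∀ v : ℂ ⊗[ℚ] V, (2 : ℂ)⁻¹ • (v + Θ v) + (2 : ℂ)⁻¹ • (v - Θ v) = v := fun v => by module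
  have hrais : ∀ X : Module.End ℂ (ℂ ⊗[ℚ] V), (∀ p ∈ H.piece 1 0, X p = 0) → (∀ v, X v ∈ H.piece 1 0) →
      Θ * X = X ∧ X * Θ = -X := fun X hXP hXim => by
    refine ⟨LinearMap.ext fun v => ?_, LinearMap.ext fun v => ?_⟩
    · rw [Module.End.mul_apply, hΘ10 _ (hXim v)]
    · rw [Module.End.mul_apply, LinearMap.neg_apply]
      conv_lhs => rw [← hPQ v, map_add, hΘ10 _ (hPmem v), hΘ01 _ (hQmem v), map_add, map_neg, hXP _ (hPmem v), zero_add]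
      conv_rhs => rw [← hPQ v, map_add, hXP _ (hPmem v), zero_add]
  have hlow : ∀ Y : Module.End ℂ (ℂ ⊗[ℚ] V), (∀ q ∈ H.piece 0 1, Y q = 0) → (∀ v, Y v ∈ H.piece 0 1) →
      Θ * Y = -Y ∧ Y * Θ = Y := fun Y hYQ hYim => by
    refine ⟨LinearMap.ext fun v => ?_, LinearMap.ext fun v => ?_⟩
    · rw [Module.End.mul_apply, LinearMap.neg_apply, hΘ01 _ (hYim v)]
    · rw [Module.End.mul_apply]
      conv_lhs => rw [← hPQ v, map_add, hΘ10 _ (hPmem v), hΘ01 _ (hQmem v), map_add, map_neg, hYQ _ (hQmem v),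
        neg_zero, add_zero]
      conv_rhs => rw [← hPQ v, map_add, hYQ _ (hQmem v), add_zero]
  obtain ⟨hΘB, hBΘ⟩ := hrais B hBP hBim
  obtain ⟨hΘy, hyΘ⟩ := hrais y hyP hyim
  obtain ⟨hΘC', hCΘ⟩ := hlow C hCQ hCim
  obtain ⟨hΘyb, hybΘ⟩ := hlow yb hybQ hybim
  have hlevi : ∀ X Y : Module.End ℂ (ℂ ⊗[ℚ] V), Θ * X = X → X * Θ = -X → Θ * Y = -Y → Y * Θ = Y →
      Θ * (X * Y - Y * X) = (X * Y - Y * X) * Θ := fun X Y h1 h2 h3 h4 => by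
    rw [mul_sub, sub_mul, ← mul_assoc, ← mul_assoc, h1, h3, mul_assoc X Y Θ, h4, mul_assoc Y X Θ, h2,
      show (-Y) * X = -(Y * X) from neg_mul Y X, show Y * (-X) = -(Y * X) from mul_neg Y X]
  have hΘL0 := hlevi B C hΘB hBΘ hΘC' hCΘ
  have hΘL1 := hlevi B yb hΘB hBΘ hΘyb hybΘ
  have hΘL2 := hlevi y C hΘy hyΘ hΘC' hCΘ
  -- independence of the raising pair and of the lowering pair
  have hRind : ∀ c₀ c₁ : ℂ, c₀ • B + c₁ • y = 0 → c₀ = 0 ∧ c₁ = 0 := by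
    intro c₀ c₁ h
    have hc₁ : c₁ = 0 := by
      by_contra hne
      refine hyB (-(c₁⁻¹ * c₀)) ?_
      have h' : y = c₁⁻¹ • (c₀ • B + c₁ • y) - (c₁⁻¹ * c₀) • B := by
        rw [smul_add, smul_smul, smul_smul, inv_mul_cancel₀ hne, one_smul]
        abel
      rw [h', h, smul_zero, zero_sub]
      exact (neg_smul _ _).symm
    rw [hc₁, zero_smul, add_zero] at h
    exact ⟨(smul_eq_zero.1 h).resolve_right hB0, hc₁⟩
  have hLind : ∀ c₂ c₃ : ℂ, c₂ • C + c₃ • yb = 0 → c₂ = 0 ∧ c₃ = 0 := by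
    intro c₂ c₃ h
    have h' : starRingEnd ℂ c₂ • B + starRingEnd ℂ c₃ • y = 0 := LinearMap.ext fun v => by
      have hv := congrArg (fun X : Module.End ℂ (ℂ ⊗[ℚ] V) => conj (X (conj v))) h
      simp only [LinearMap.add_apply, LinearMap.smul_apply, LinearMap.zero_apply, map_zero, map_add, conj_smul, hcC,
        hcyb, conj_conj] at hv
      simpa only [LinearMap.add_apply, LinearMap.smul_apply, LinearMap.zero_apply] using hv
    obtain ⟨h2, h3⟩ := hRind _ _ h'
    exact ⟨(map_eq_zero (starRingEnd ℂ)).1 h2, (map_eq_zero (starRingEnd ℂ)).1 h3⟩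
  -- test vectors for the three Levi elements
  have hT1L0 : ∀ u', u' ∈ H.piece 1 0 → E u' = 0 → (B * C - C * B) u' = 0 := fun u' hu' hEu' => by
    rw [LinearMap.sub_apply, Module.End.mul_apply, Module.End.mul_apply, hBP u' hu', map_zero, sub_zero,
      ← hCE, Module.End.mul_apply, hEu', map_zero, map_zero]
  have hT1L2 : ∀ u', u' ∈ H.piece 1 0 → E u' = 0 → (y * C - C * y) u' = 0 := fun u' hu' hEu' => by
    rw [LinearMap.sub_apply, Module.End.mul_apply, Module.End.mul_apply, hyP u' hu', map_zero, sub_zero,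
      ← hCE, Module.End.mul_apply, hEu', map_zero, map_zero]
  have hT1L1 : ∀ u', u' ∈ H.piece 1 0 → (B * yb - yb * B) u' = B (yb u') := fun u' hu' => by
    rw [LinearMap.sub_apply, Module.End.mul_apply, Module.End.mul_apply, hBP u' hu', map_zero, sub_zero]
  have hT2L0 : ∀ v, (B * C - C * B) (B v) = t • B v := fun v => by
    rw [LinearMap.sub_apply, Module.End.mul_apply, Module.End.mul_apply, show B (B v) = (B * B) v from rfl, hBB,
      LinearMap.zero_apply, map_zero, sub_zero, show B (C (B v)) = (B * C * B) v from rfl, hBCB, LinearMap.smul_apply]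
  have hT2L1 : ∀ v, (B * yb - yb * B) (B v) = 0 := fun v => by
    rw [LinearMap.sub_apply, Module.End.mul_apply, Module.End.mul_apply, show B (B v) = (B * B) v from rfl, hBB,
      LinearMap.zero_apply, map_zero, sub_zero, hyb, hcB, show y (C (conj v)) = (y * C) (conj v) from rfl, hyC,
      Module.End.mul_apply, ← hcC, show C (a' (C (conj v))) = (C * a') (C (conj v)) from rfl, hCa',
      LinearMap.zero_apply, map_zero]
  have hT2L2 : ∀ v, (y * C - C * y) (B v) = a' (C (B v)) ∧ E (a' (C (B v))) = 0 := fun v => by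
    constructor
    · rw [LinearMap.sub_apply, Module.End.mul_apply, Module.End.mul_apply, hyP _ (hBim v), map_zero, sub_zero,
        show y (C (B v)) = (y * C) (B v) from rfl, hyC, Module.End.mul_apply]
    · rw [show E (a' (C (B v))) = (E * a') (C (B v)) from rfl, hEa', LinearMap.zero_apply]
  -- existence of good test vectors
  obtain ⟨u₁, hu₁P, hEu₁, hu₁⟩ : ∃ u', u' ∈ H.piece 1 0 ∧ E u' = 0 ∧ B (yb u') ≠ 0 := by
    obtain ⟨v, hv⟩ : ∃ v, a v ≠ 0 := by
      by_contra h
      push Not at h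
      exact ha0 (LinearMap.ext fun v => by rw [h v, LinearMap.zero_apply])
    have haPv : a ((2 : ℂ)⁻¹ • (v + Θ v)) = 0 := by rw [ha, Module.End.mul_apply, hyP _ (hPmem v), map_zero]
    obtain ⟨w', hw'⟩ : ∃ w', w' = (2 : ℂ)⁻¹ • (v - Θ v) - F ((2 : ℂ)⁻¹ • (v - Θ v)) := ⟨_, rfl⟩
    have hw'Q : w' ∈ H.piece 0 1 := by
      rw [hw', hF, LinearMap.smul_apply, Module.End.mul_apply]
      exact Submodule.sub_mem _ (hQmem v) (Submodule.smul_mem _ _ (hCim _))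
    have haw' : a w' = a v := by
      conv_rhs => rw [← hPQ v, map_add, haPv, zero_add]
      rw [hw', map_sub, ← Module.End.mul_apply a F, haF, LinearMap.zero_apply, sub_zero]
    refine ⟨conj w', conj_mem_piece H hw'Q, ?_, ?_⟩
    · rw [← hconjF, hw', map_sub, ← Module.End.mul_apply F F, hFF, sub_self, map_zero]
    · rw [hyb, conj_conj, ← hcC]
      intro h0
      have h1 : C (y w') = 0 := by
        have := congrArg conj h0
        rwa [conj_conj, map_zero] at this
      rw [hya, LinearMap.add_apply, map_add, ← Module.End.mul_apply C a', hCa', LinearMap.zero_apply, add_zero] at h1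
      -- `C (a w') = 0` forces `a w' = 0` (`a w' = E (a w') = t⁻¹ B C (a w')`)
      have h2 : a w' = 0 := by
        rw [← haE, hE, LinearMap.smul_apply, Module.End.mul_apply, h1, map_zero, smul_zero]
      exact hv (by rw [← haw', h2])
  obtain ⟨v₂, hv₂⟩ : ∃ v, (y * C - C * y) (B v) ≠ 0 := by
    obtain ⟨v, hv⟩ : ∃ v, a' v ≠ 0 := by
      by_contra h
      push Not at h
      exact ha'0 (LinearMap.ext fun v => by rw [h v, LinearMap.zero_apply])
    refine ⟨t⁻¹ • v, fun h0 => hv ?_⟩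
    rw [(hT2L2 _).1, map_smul, map_smul, map_smul, smul_eq_zero] at h0
    rcases h0 with h0 | h0
    · exact absurd h0 (inv_ne_zero ht)
    · rw [ha', Module.End.mul_apply, show F (C (B v)) = (F * C) (B v) from rfl, hFC] at h0
      rw [ha', Module.End.mul_apply, hF, LinearMap.smul_apply, Module.End.mul_apply, map_smul, h0, smul_zero]
  obtain ⟨v₃, hv₃⟩ : ∃ v, B v ≠ 0 := by
    by_contra h
    push Not at h
    exact hB0 (LinearMap.ext fun v => by rw [h v, LinearMap.zero_apply])
  -- linear independence of the seven
  have hindep : ∀ g : Fin 7 → ℂ, g 0 • B + g 1 • y + g 2 • C + g 3 • yb + g 4 • (B * C - C * B) +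
      g 5 • (B * yb - yb * B) + g 6 • (y * C - C * y) = 0 → ∀ i, g i = 0 := by
    intro g hsum
    obtain ⟨R, hR⟩ : ∃ R : Module.End ℂ (ℂ ⊗[ℚ] V), R = g 0 • B + g 1 • y := ⟨_, rfl⟩
    obtain ⟨Lw, hLw⟩ : ∃ Lw : Module.End ℂ (ℂ ⊗[ℚ] V), Lw = g 2 • C + g 3 • yb := ⟨_, rfl⟩
    obtain ⟨Lv, hLv⟩ : ∃ Lv : Module.End ℂ (ℂ ⊗[ℚ] V),
        Lv = g 4 • (B * C - C * B) + g 5 • (B * yb - yb * B) + g 6 • (y * C - C * y) := ⟨_, rfl⟩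
    have hsum' : R + Lw + Lv = 0 := by rw [hR, hLw, hLv, ← hsum]; abel
    have hΘR : Θ * R = R := by rw [hR, mul_add, mul_smul_comm, mul_smul_comm, hΘB, hΘy]
    have hRΘ : R * Θ = -R := by rw [hR, add_mul, smul_mul_assoc, smul_mul_assoc, hBΘ, hyΘ, smul_neg, smul_neg, neg_add]
    have hΘLw : Θ * Lw = -Lw := by
      rw [hLw, mul_add, mul_smul_comm, mul_smul_comm, hΘC', hΘyb, smul_neg, smul_neg, neg_add]
    have hLwΘ : Lw * Θ = Lw := by rw [hLw, add_mul, smul_mul_assoc, smul_mul_assoc, hCΘ, hybΘ]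
    have hΘLv : Θ * Lv = Lv * Θ := by
      rw [hLv, mul_add, mul_add, add_mul, add_mul, mul_smul_comm, mul_smul_comm, mul_smul_comm, smul_mul_assoc,
        smul_mul_assoc, smul_mul_assoc, hΘL0, hΘL1, hΘL2]
    have E1 : R - Lw + Θ * Lv = 0 := by
      have h := congrArg (fun X => Θ * X) hsum'
      simp only [mul_add, hΘR, hΘLw, mul_zero] at h
      rw [← h]
      abel
    have E2 : -R + Lw + Θ * Lv = 0 := by
      have h := congrArg (fun X => X * Θ) hsum'
      simp only [add_mul, hRΘ, hLwΘ, ← hΘLv, zero_mul] at h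
      rw [← h]
    have E3 : R - Lw = 0 := by
      have h : (R - Lw + Θ * Lv) - (-R + Lw + Θ * Lv) = 0 := by rw [E1, E2, sub_zero]
      have h2 : (2 : ℂ) • (R - Lw) = 0 := by rw [← h]; module
      exact (smul_eq_zero.1 h2).resolve_left (two_ne_zero' ℂ)
    have E4 : R + Lw = 0 := by
      have h := congrArg (fun X => Θ * X) E3
      simp only [mul_sub, hΘR, hΘLw, mul_zero, sub_neg_eq_add] at h
      exact h
    have hR0 : R = 0 := by
      have h2 : (2 : ℂ) • R = 0 := by rw [show (2 : ℂ) • R = (R - Lw) + (R + Lw) by module, E3, E4, add_zero]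
      exact (smul_eq_zero.1 h2).resolve_left (two_ne_zero' ℂ)
    have hLw0 : Lw = 0 := by rw [hR0, zero_add] at E4; exact E4
    have hLv0 : Lv = 0 := by rw [hR0, hLw0, zero_add, zero_add] at hsum'; exact hsum'
    obtain ⟨hg0, hg1⟩ := hRind (g 0) (g 1) (by rw [← hR]; exact hR0)
    obtain ⟨hg2, hg3⟩ := hLind (g 2) (g 3) (by rw [← hLw]; exact hLw0)
    -- the Levi part on the test vectors
    have hg5 : g 5 = 0 := by
      have h := congrArg (fun X : Module.End ℂ (ℂ ⊗[ℚ] V) => X u₁) hLv0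
      simp only [hLv, LinearMap.add_apply, LinearMap.smul_apply, LinearMap.zero_apply, hT1L0 u₁ hu₁P hEu₁,
        hT1L2 u₁ hu₁P hEu₁, hT1L1 u₁ hu₁P, smul_zero, zero_add, add_zero] at h
      exact (smul_eq_zero.1 h).resolve_right hu₁
    have hg4 : g 4 = 0 := by
      have h := congrArg (fun X : Module.End ℂ (ℂ ⊗[ℚ] V) => E (X (B v₃))) hLv0
      simp only [hLv, hg5, zero_smul, add_zero, LinearMap.add_apply, LinearMap.smul_apply, LinearMap.zero_apply,
        map_zero, map_add, map_smul, hT2L0, (hT2L2 v₃).1, (hT2L2 v₃).2, smul_zero] at h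
      -- h : g 4 • (t • E (B v₃)) = 0
      have hEB3 : E (B v₃) = B v₃ := by rw [← Module.End.mul_apply, hEB]
      rw [hEB3, smul_smul, smul_eq_zero] at h
      rcases h with h | h
      · exact (mul_eq_zero.1 h).resolve_right ht
      · exact absurd h hv₃
    have hg6 : g 6 = 0 := by
      have h := congrArg (fun X : Module.End ℂ (ℂ ⊗[ℚ] V) => X (B v₂)) hLv0
      simp only [hLv, hg4, hg5, zero_smul, zero_add, LinearMap.smul_apply, LinearMap.zero_apply] at h
      exact (smul_eq_zero.1 h).resolve_right hv₂
    intro i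
    fin_cases i
    · exact hg0
    · exact hg1
    · exact hg2
    · exact hg3
    · exact hg4
    · exact hg5
    · exact hg6
  have hli : LinearIndependent ℂ ![B, y, C, yb, B * C - C * B, B * yb - yb * B, y * C - C * y] := by
    rw [Fintype.linearIndependent_iff]
    intro g hg
    rw [Fin.sum_univ_seven] at hg
    simp only [Matrix.cons_val_zero, Matrix.cons_val_one, Matrix.cons_val] at hg
    exact hindep g hg
  have hle : Submodule.span ℂ (Set.range ![B, y, C, yb, B * C - C * B, B * yb - yb * B, y * C - C * y]) ≤ 𝔰 := by
    rw [Submodule.span_le]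
    rintro _ ⟨i, rfl⟩
    fin_cases i
    · exact hB𝔰
    · exact hy𝔰
    · exact hC𝔰
    · exact hyb𝔰
    · exact hL0
    · exact hL1
    · exact hL2
  have h := Submodule.finrank_mono hle
  rw [finrank_span_eq_card hli, Fintype.card_fin] at h
  exact h


/-! ## §2 `End_Hdg = ℚ`, minimal raising rank `r ≤ 4`, `r < dim V^{1,0}`: `Lie Hg ⊗ ℂ` is simple -/

set_option maxHeartbeats 3200000 in
/-- **`Lie Hg ⊗ ℂ` is simple when the minimal raising rank is `≤ 4` and `< dim V^{1,0}`** (`H` effective polarized of weight `1`,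
`End_Hdg = ℚ`): every non-zero `ad 𝔥_ℂ`-stable subspace of `𝔥_ℂ` is `𝔥_ℂ` — for N2's splitting `𝔥_ℂ = 𝔰₁ ⊕ 𝔠` one has
`dim 𝔠 ≤ 6 < 7 ≤ dim 𝔰₁`, so the Jacobson clause forces `𝔠 = 0`.  In the rank-twelve case this applies to the whole crux range
`r ∈ {2, 3, 4}` of `rankTwelve_sp_or_exists_minimal_raising`. [cite: MoonenZarhin1999LowDim, §2 (2.3)–(2.5) and §3 (3.1)]
[cite: Deligne1982HodgeCycles, I §3 Prop. 3.4, Prop. 3.6, Example 3.7] [cite: Jacobson1962LieAlgebras, Ch. X §1 Theorems 1–3] -/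
theorem hodgeLieC_simple_of_minimal_rank_le_four [Nontrivial V] (H : HodgeStructure V n) (ψ : H.Polarization)
    (hn : n = 1) (heff : H.IsEffective) (hE : ∀ a ∈ H.endAlg, ∃ x : ℚ, a = x • (1 : Module.End ℚ V))
    {B C : Module.End ℂ (ℂ ⊗[ℚ] V)} (hB : B ∈ H.hodgeLieC) (hB0 : B ≠ 0) (hBP : ∀ p ∈ H.piece 1 0, B p = 0)
    (hBim : ∀ v, B v ∈ H.piece 1 0) (hC : ∀ v, C v = conj (B (conj v)))
    (hmin : ∀ B' ∈ H.hodgeLieC, B' ≠ 0 → (∀ p ∈ H.piece 1 0, B' p = 0) → (∀ v, B' v ∈ H.piece 1 0) →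
      Module.finrank ℂ (LinearMap.range B) ≤ Module.finrank ℂ (LinearMap.range B'))
    (hr4 : Module.finrank ℂ (LinearMap.range B) ≤ 4)
    (hrg : Module.finrank ℂ (LinearMap.range B) < Module.finrank ℂ (H.piece 1 0)) :
    ∀ T : Submodule ℂ (Module.End ℂ (ℂ ⊗[ℚ] V)), T ≤ H.hodgeLieC → T ≠ ⊥ →
      (∀ Y ∈ H.hodgeLieC, ∀ t ∈ T, Y * t - t * Y ∈ T) → T = H.hodgeLieC := by
  classical
  obtain ⟨hbr, hskew, -, Θ, hΘ, hΘ𝔤⟩ := hodgeLie_standing H ψ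
  have hspan : H.hodgeLieC = spanC H.hodgeLie := hodgeLieC_eq_spanC H
  have hΘC : Θ ∈ H.hodgeLieC := by rw [hspan]; exact hΘ𝔤
  have hbrC : ∀ Y ∈ H.hodgeLieC, ∀ Z ∈ H.hodgeLieC, Y * Z - Z * Y ∈ H.hodgeLieC := fun Y hY Z hZ => by
    rw [hspan] at hY hZ ⊢
    exact commutator_mem_spanC hbr hY hZ
  have hconj : ∀ Z ∈ H.hodgeLieC, ∀ Z' : Module.End ℂ (ℂ ⊗[ℚ] V), (∀ v, Z' v = conj (Z (conj v))) →
      Z' ∈ H.hodgeLieC := fun Z hZ Z' hZ' => by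
    rw [hspan] at hZ ⊢
    exact conjOp_mem_spanC hZ hZ'
  have hirr : ∀ U : Submodule ℂ (ℂ ⊗[ℚ] V), (∀ Z ∈ H.hodgeLieC, ∀ u ∈ U, Z u ∈ U) → U = ⊥ ∨ U = ⊤ :=
    fun U hU => SymplecticTheta.eq_bot_or_top_of_stable H hn heff ψ hE H.hodgeLie hΘ hΘ𝔤 hskew
      fun X hX u hu => hU _ (by rw [hspan]; exact baseChange_mem_spanC hX) u hu
  have hC𝔊 : C ∈ H.hodgeLieC := hconj B hB C hC
  obtain ⟨t, ht, hBCB⟩ :=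
    WeightOneMinimalRaising.mul_conjOp_mul_eq_smul H ψ hn heff hΘ le_rfl hbrC hB hB0 hBP hBim hC hC𝔊 hmin
  obtain ⟨𝔰₁, 𝔠, -, h𝔠, -, hsup, had𝔰, had𝔠, hcomm, -, hmin𝔰, -, hraise, hlower, hΘ𝔠, hclause⟩ :=
    exists_thetaIdeal_of_forall_endAlg_eq_smul H ψ hn heff hE hΘ
  have hB𝔰 : B ∈ 𝔰₁ := hraise B hB hBP hBim
  -- `dim 𝔠 ≤ 6`
  have hsplit : ∀ Z ∈ H.hodgeLieC, ∃ s z : Module.End ℂ (ℂ ⊗[ℚ] V), Z = s + z ∧ z ∈ 𝔠 ∧ ∀ c ∈ 𝔠, s * c = c * s :=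
    fun Z hZ => by
      rw [← hsup] at hZ
      obtain ⟨s, hs, z, hz, rfl⟩ := Submodule.mem_sup.1 hZ
      exact ⟨s, z, rfl, hz, fun c hc => hcomm s hs c hc⟩
  have hcB : ∀ c ∈ 𝔠, c * B = B * c := fun c hc => (hcomm B hB𝔰 c hc).symm
  have h𝔠6 : Module.finrank ℂ 𝔠 ≤ 6 :=
    WeightOneCommutant.finrank_le_six_of_finrank_range_le_four H ψ hn heff hΘ hirr h𝔠 had𝔠 hsplit hΘ𝔠 hB hB0 hBP hBim
      hcB hr4
  -- `dim 𝔰₁ ≥ 7`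
  obtain ⟨y, hy, hy0, hyP, hyim, hy1, hyB⟩ :=
    WeightOnePeirce.exists_peirceOne H hn heff hΘ hbrC hΘC hconj hirr hB hB0 hBP hBim hC ht hBCB hrg
  obtain ⟨yb, hyb⟩ := exists_conjOp y
  have hyb𝔊 : yb ∈ H.hodgeLieC := hconj y hy yb hyb
  have hy𝔰 : y ∈ 𝔰₁ := hraise y hy hyP hyim
  have h7 : 7 ≤ Module.finrank ℂ 𝔰₁ := by
    subst hn
    obtain ⟨hCQ, hCim, -, -⟩ := SymplecticThetaTen.conjOp_raise (P := H.piece 1 0) (Q := H.piece 0 1)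
      (fun x hx => conj_mem_piece H hx) (fun x hx => conj_mem_piece H hx) hBP hBim hC
    obtain ⟨hybQ, hybim, -, -⟩ := SymplecticThetaTen.conjOp_raise (P := H.piece 1 0) (Q := H.piece 0 1)
      (fun x hx => conj_mem_piece H hx) (fun x hx => conj_mem_piece H hx) hyP hyim hyb
    have hC𝔰 : C ∈ 𝔰₁ := hlower C hC𝔊 hCQ hCim
    have hyb𝔰 : yb ∈ 𝔰₁ := hlower yb hyb𝔊 hybQ hybim
    exact WeightOnePeirce.seven_le_finrank H ψ rfl heff hΘ hB hB0 hBP hBim hC hC𝔊 ht hBCB hy hy0 hyP hyim hy1 hyB hyb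
      hyb𝔊 hB𝔰 hy𝔰 hC𝔰 hyb𝔰 (had𝔰 B hB C hC𝔰) (had𝔰 B hB yb hyb𝔰) (had𝔰 y hy C hC𝔰)
  -- the Jacobson clause leaves `𝔠 = 0`
  have h𝔠0 : 𝔠 = ⊥ := by
    rcases hclause with h | ⟨W, hW𝔠, -, -, hWdim⟩
    · exact h
    · exfalso
      have h := Submodule.finrank_mono hW𝔠
      omega
  rw [h𝔠0, sup_bot_eq] at hsup
  intro T hT hT0 hTad
  rw [← hsup] at hT ⊢
  exact hmin𝔰 T hT hT0 hTad


/-! ## §3 Rank twelve: `Hg = Sp₁₂`, or a minimal tripotent of rank `2, 3, 4` inside a SIMPLE `Lie Hg ⊗ ℂ` -/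

/-- **Rank twelve, `End_Hdg = ℚ`: either `Lie Hg ⊗ ℂ = 𝔰𝔭(V_ℂ, ψ_ℂ)`, or `Lie Hg ⊗ ℂ` is simple and contains a minimal raising
tripotent of rank `2`, `3` or `4`** (N6 `rankTwelve_sp_or_exists_minimal_raising` + §2).  This is the exact residual crux of the
cell's TABLE X row 1: the second alternative has no model in the classification (only `𝔰𝔭₁₂` carries a `12`-dimensional symplectic
representation with a weight-one Hodge grading), but is not excluded here. [cite: MoonenZarhin1999LowDim, §2 (2.3)–(2.5) and §3 (3.1)]
[cite: Deligne1982HodgeCycles, I §3 Prop. 3.4, Prop. 3.6, Example 3.7] -/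
theorem rankTwelve_sp_or_simple (H : HodgeStructure V n) (hn : n = 1) (heff : H.IsEffective) (ψ : H.Polarization)
    (hE : ∀ a ∈ H.endAlg, ∃ x : ℚ, a = x • (1 : Module.End ℚ V)) (hV : Module.finrank ℚ V = 12) :
    (∀ Y : Module.End ℂ (ℂ ⊗[ℚ] V),
        (∀ x y, ψ.form.baseChange ℂ (Y x) y + ψ.form.baseChange ℂ x (Y y) = 0) → Y ∈ H.hodgeLieC) ∨
      ((∃ B C : Module.End ℂ (ℂ ⊗[ℚ] V), B ∈ H.hodgeLieC ∧ B ≠ 0 ∧ (∀ p ∈ H.piece 1 0, B p = 0) ∧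
          (∀ v, B v ∈ H.piece 1 0) ∧ (∀ v, C v = conj (B (conj v))) ∧
          (∀ B' ∈ H.hodgeLieC, B' ≠ 0 → (∀ p ∈ H.piece 1 0, B' p = 0) → (∀ v, B' v ∈ H.piece 1 0) →
            Module.finrank ℂ (LinearMap.range B) ≤ Module.finrank ℂ (LinearMap.range B')) ∧
          2 ≤ Module.finrank ℂ (LinearMap.range B) ∧ Module.finrank ℂ (LinearMap.range B) ≤ 4) ∧
        ∀ T : Submodule ℂ (Module.End ℂ (ℂ ⊗[ℚ] V)), T ≤ H.hodgeLieC → T ≠ ⊥ →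
          (∀ Y ∈ H.hodgeLieC, ∀ t ∈ T, Y * t - t * Y ∈ T) → T = H.hodgeLieC) := by
  rcases rankTwelve_sp_or_exists_minimal_raising H hn heff ψ hE hV with h | ⟨B, C, hB, hB0, hBP, hBim, hC, hmin, h2, h4⟩
  · exact Or.inl h
  · right
    refine ⟨⟨B, C, hB, hB0, hBP, hBim, hC, hmin, h2, h4⟩, ?_⟩
    haveI : Nontrivial V := Module.nontrivial_of_finrank_pos (R := ℚ) (by rw [hV]; norm_num)
    obtain ⟨Θ, hΘ⟩ := exists_hodgeTheta H
    obtain ⟨hP6, -⟩ := finrank_pieces_eq_of_weightOne H hn heff (m := 6) (by rw [hV]) hΘ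
    exact hodgeLieC_simple_of_minimal_rank_le_four H ψ hn heff hE hB hB0 hBP hBim hC hmin h4 (by omega)

end HodgeStructure

end Literature.AlgebraicGeometry.Motives
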